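import Mathlib

/-! critic scrit-stub_cmLambdaLower g10 — independent kernel re-check of the k4-g8 card's
    small-case certificates (C1/C2: common cubic field of 19a1[2] and 361a1[2]; C3: point counts
    over 𝔽₂; A3/A4/A4′: multiplication by i on (ℤ/4)[i], (ℤ/8)[i]).  Not a route file. -/

namespace Summit.BirchSwinnertonDyer.BirchSwinnertonDyer.Cruxes.ResidualThetaCountLowerPureAtTwo.ScritG10Certs

/-- C1: the 2-division cubic of 19a1 = [0,1,1,-9,-15], `4x³+4x²-36x-59`, has the root
`α = (-2+3γ+γ²)/2` in `ℚ(γ)`, `γ³ = 2γ+2` (denominators cleared: we check `2·(…) = 0`). -/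
theorem twoDivision_19a1_root {K : Type*} [Field K] [CharZero K] (γ : K)
    (hγ : γ ^ 3 = 2 * γ + 2) :
    4 * ((-2 + 3 * γ + γ ^ 2) / 2) ^ 3 + 4 * ((-2 + 3 * γ + γ ^ 2) / 2) ^ 2
      - 36 * ((-2 + 3 * γ + γ ^ 2) / 2) - 59 = 0 := by
  linear_combination ((1/2 : K) * γ ^ 3 + (9/2 : K) * γ ^ 2 + (25/2 : K) * γ + 23/2) * hγ

/-- C2: the 2-division cubic of 361a1 = [0,0,1,-38,90], `4x³-152x+361`, has the root
`β = (4-5γ-3γ²)/2` in the same field. -/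
theorem twoDivision_361a1_root {K : Type*} [Field K] [CharZero K] (γ : K)
    (hγ : γ ^ 3 = 2 * γ + 2) :
    4 * ((4 - 5 * γ - 3 * γ ^ 2) / 2) ^ 3 - 152 * ((4 - 5 * γ - 3 * γ ^ 2) / 2) + 361 = 0 := by
  linear_combination (-(27/2 : K) * γ ^ 3 - (135/2 : K) * γ ^ 2 - (171/2 : K) * γ - 89/2) * hγ

/-- C3: affine point counts over 𝔽₂: 19a1 ↦ 2, 361a1 ↦ 2 (so `#E(𝔽₂) = 3`, `a₂ = 0`),
49a1 = [1,-1,0,-2,-1] ↦ 1 (`#E(𝔽₂) = 2`, `a₂ = 1`, ordinary). -/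
theorem affine_counts_mod_two :
    (Finset.univ.filter (fun p : ZMod 2 × ZMod 2 =>
        p.2 ^ 2 + p.2 = p.1 ^ 3 + p.1 ^ 2 - 9 * p.1 - 15)).card = 2 ∧
    (Finset.univ.filter (fun p : ZMod 2 × ZMod 2 =>
        p.2 ^ 2 + p.2 = p.1 ^ 3 - 38 * p.1 + 90)).card = 2 ∧
    (Finset.univ.filter (fun p : ZMod 2 × ZMod 2 =>
        p.2 ^ 2 + p.1 * p.2 = p.1 ^ 3 - p.1 ^ 2 - 2 * p.1 - 1)).card = 1 := by
  decide

/-- A3: multiplication by `i` on `(ℤ/4)[i] ≅ (ℤ/4)²`, `(a,b) ↦ (-b,a)`, has exactly 2 fixed vectors. -/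
theorem rot_fixed_mod4 :
    (Finset.univ.filter (fun v : ZMod 4 × ZMod 4 => (-v.2, v.1) = v)).card = 2 := by decide

/-- A3′: same over `ℤ/8`. -/
theorem rot_fixed_mod8 :
    (Finset.univ.filter (fun v : ZMod 8 × ZMod 8 => (-v.2, v.1) = v)).card = 2 := by decide

/-- A4: the image of `σ - 1`, `(a,b) ↦ (-b-a, a-b)`, on `(ℤ/4)²` has 8 of 16 elements
(cokernel `≅ ℤ/2`). -/
theorem rotSubOne_image_mod4 :
    (Finset.univ.image (fun v : ZMod 4 × ZMod 4 => (-v.2 - v.1, v.1 - v.2))).card = 8 := by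
  decide

/-- A4′: over `ℤ/8` every `2v` lies in the image of `σ - 1` (the `ℤ/2` of A4 dies in `A[8]`). -/
theorem two_smul_mem_rotSubOne_image_mod8 :
    ∀ v : ZMod 8 × ZMod 8, ∃ u : ZMod 8 × ZMod 8,
      (-u.2 - u.1, u.1 - u.2) = (2 * v.1, 2 * v.2) := by
  decide

end Summit.BirchSwinnertonDyer.BirchSwinnertonDyer.Cruxes.ResidualThetaCountLowerPureAtTwo.ScritG10Certs
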